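import Summits.Parity.GeneralizedHardyLittlewood.Theorems.BeyondDiagonalBeatsQuarter.MellinBumpBV
import HarnessLib

/-!
# Route `PrimeLevelFamEdge`, crux K_B (stmt-Parity-20343), line `diagonal_kernel_split` rev 4, plan Ω:
# **C1 with a bounded-turn phase** (`MellinBumpPhase`, OMEGA-BLUEPRINT v4 §3c / TRANSITION-SIZING §4.2, §7)

The Mellin-bump lemma `MellinBump.mellinBump_xsq_bv` bounds
`Σ_{m₁,m₂ ≤ M} (x_{m₁}/m₁)(x_{m₂}/m₂)·h(m₁m₂/Y)` by `D·((2B + K(b−a))(1+|log b|) + 2K√(bY)/Y)/(1 + log Y)^k`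
for a `K`-Lipschitz window `h` supported in `[a,b] ⊂ [a₀,∞)` with `|h| ≤ B`; its constant is LINEAR in `K`. The
short-moduli principal terms of the dual side (E14 `principalBlock_eq_latticeSamples`) carry, against the same
Möbius weights, the window TIMES a linear phase `e(−m₁m₂·k/(d₁d₂qc))`; writing the phase as
`cos/sin(2π·Θ·(m₁m₂/Y))` with `Θ = Yk/(d₁d₂qc)` the number of turns over the window, the product window is
`(K + 2π|Θ|B)`-Lipschitz, so C1 applies VERBATIM with `K ↦ K + 2π|Θ|B`:

* `mellinBump_xsq_cos` / `mellinBump_xsq_sin` — the cosine and sine twins (real and imaginary parts of the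
  phase; C1 is stated over `ℝ`).

This is the tool for the regime `Θ ≤ polylog` (few turns: `lm ≲ 4q̂²X`, `k ≤ L^B` of TRANSITION-SIZING §4.2/§7);
it is USELESS when `Θ ≍ q̂^{η}` (§3.1 of the memo: the bound is then worse than trivial) — that regime is the
unfunded piece L5′ and nothing here bears on it. Helper toward `stub_offDiagBelowSlack_io` (consumer: the
a8P-short bound after S4); closes nothing; theorems only; standard axioms.
«The programme SEARCHES and TYPES; no claim about Landau–Siegel zeros, Theorems 1–2 of arXiv:2211.02515 or
a repaired Margin232 until a kernel theorem says so.»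
-/

noncomputable section

open scoped Real
open Finset

namespace Summit.Parity.GeneralizedHardyLittlewood.Theorems.BeyondDiagonalBeatsQuarter.MellinBump

open Literature.NumberTheory.LFunctions Literature.NumberTheory.LFunctions.KMV2000
open KernelFormXSq

/-- A `K`-Lipschitz function bounded by `B` times a `2π|Θ|`-frequency cosine is `(K + 2π|Θ|B)`-Lipschitz.
[folklore] -/
private theorem lipschitz_mul_cos {h : ℝ → ℝ} {K B Θ : ℝ} (hLip : ∀ x y, |h x - h y| ≤ K * |x - y|)
    (hB : ∀ y, |h y| ≤ B) (x y : ℝ) :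
    |h x * Real.cos (2 * π * Θ * x) - h y * Real.cos (2 * π * Θ * y)| ≤ (K + 2 * π * |Θ| * B) * |x - y| := by
  have hcos : |Real.cos (2 * π * Θ * x) - Real.cos (2 * π * Θ * y)| ≤ 2 * π * |Θ| * |x - y| := by
    have h1 := Real.lipschitzWith_cos.dist_le_mul (2 * π * Θ * x) (2 * π * Θ * y)
    rw [Real.dist_eq, Real.dist_eq, NNReal.coe_one, one_mul] at h1
    calc |Real.cos (2 * π * Θ * x) - Real.cos (2 * π * Θ * y)| ≤ |2 * π * Θ * x - 2 * π * Θ * y| := h1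
      _ = 2 * π * |Θ| * |x - y| := by
          rw [← mul_sub, abs_mul, abs_mul, abs_of_pos Real.two_pi_pos]
  have hB0 : 0 ≤ B := (abs_nonneg _).trans (hB 0)
  calc |h x * Real.cos (2 * π * Θ * x) - h y * Real.cos (2 * π * Θ * y)|
      = |(h x - h y) * Real.cos (2 * π * Θ * x) +
          h y * (Real.cos (2 * π * Θ * x) - Real.cos (2 * π * Θ * y))| := by ring_nf
    _ ≤ |(h x - h y) * Real.cos (2 * π * Θ * x)| +
          |h y * (Real.cos (2 * π * Θ * x) - Real.cos (2 * π * Θ * y))| := abs_add_le _ _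
    _ ≤ K * |x - y| * 1 + B * (2 * π * |Θ| * |x - y|) := by
        rw [abs_mul, abs_mul]
        exact add_le_add (mul_le_mul (hLip x y) (Real.abs_cos_le_one _) (abs_nonneg _)
            (le_trans (abs_nonneg _) (hLip x y)))
          (mul_le_mul (hB y) hcos (abs_nonneg _) hB0)
    _ = (K + 2 * π * |Θ| * B) * |x - y| := by ring

/-- The sine twin of `lipschitz_mul_cos`. [folklore] -/
private theorem lipschitz_mul_sin {h : ℝ → ℝ} {K B Θ : ℝ} (hLip : ∀ x y, |h x - h y| ≤ K * |x - y|)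
    (hB : ∀ y, |h y| ≤ B) (x y : ℝ) :
    |h x * Real.sin (2 * π * Θ * x) - h y * Real.sin (2 * π * Θ * y)| ≤ (K + 2 * π * |Θ| * B) * |x - y| := by
  have hsin : |Real.sin (2 * π * Θ * x) - Real.sin (2 * π * Θ * y)| ≤ 2 * π * |Θ| * |x - y| := by
    have h1 := Real.lipschitzWith_sin.dist_le_mul (2 * π * Θ * x) (2 * π * Θ * y)
    rw [Real.dist_eq, Real.dist_eq, NNReal.coe_one, one_mul] at h1
    calc |Real.sin (2 * π * Θ * x) - Real.sin (2 * π * Θ * y)| ≤ |2 * π * Θ * x - 2 * π * Θ * y| := h1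
      _ = 2 * π * |Θ| * |x - y| := by
          rw [← mul_sub, abs_mul, abs_mul, abs_of_pos Real.two_pi_pos]
  have hB0 : 0 ≤ B := (abs_nonneg _).trans (hB 0)
  calc |h x * Real.sin (2 * π * Θ * x) - h y * Real.sin (2 * π * Θ * y)|
      = |(h x - h y) * Real.sin (2 * π * Θ * x) +
          h y * (Real.sin (2 * π * Θ * x) - Real.sin (2 * π * Θ * y))| := by ring_nf
    _ ≤ |(h x - h y) * Real.sin (2 * π * Θ * x)| +
          |h y * (Real.sin (2 * π * Θ * x) - Real.sin (2 * π * Θ * y))| := abs_add_le _ _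
    _ ≤ K * |x - y| * 1 + B * (2 * π * |Θ| * |x - y|) := by
        rw [abs_mul, abs_mul]
        exact add_le_add (mul_le_mul (hLip x y) (Real.abs_sin_le_one _) (abs_nonneg _)
            (le_trans (abs_nonneg _) (hLip x y)))
          (mul_le_mul (hB y) hsin (abs_nonneg _) hB0)
    _ = (K + 2 * π * |Θ| * B) * |x - y| := by ring

/-- **C1 with a cosine phase of `Θ` turns.** For every `k : ℕ` and `a₀ > 0` there is `D > 0` (the constant of
`mellinBump_xsq_bv`) such that for all windows `a₀ ≤ a ≤ b`, all `K ≥ 0`, `B`, `Θ`, every `K`-Lipschitz `h`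
supported in `[a,b]` with `|h| ≤ B`, every `M > 1` and every `Y ≥ 1`:
`|Σ_{m₁,m₂ ≤ M} (x_{m₁}/m₁)(x_{m₂}/m₂)·h(m₁m₂/Y)·cos(2πΘ·m₁m₂/Y)|
   ≤ D·((2B + (K + 2π|Θ|B)(b − a))(1 + |log b|) + 2(K + 2π|Θ|B)·√(bY)/Y)/(1 + log Y)^k`.
[cite: KowalskiMichelVanderKam2000, Prop. 5.1 p. 18 — derivation (mollified sums with smooth bump weights); MontgomeryVaughan2007, §8.1 (8.6)] -/
theorem mellinBump_xsq_cos (k : ℕ) {a₀ : ℝ} (ha₀ : 0 < a₀) :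
    ∃ D : ℝ, 0 < D ∧ ∀ a b K B Θ : ℝ, a₀ ≤ a → a ≤ b → 0 ≤ K →
      ∀ h : ℝ → ℝ, (∀ x y, |h x - h y| ≤ K * |x - y|) →
      (∀ y, h y ≠ 0 → a ≤ y ∧ y ≤ b) → (∀ y, |h y| ≤ B) → ∀ M : ℝ, 1 < M → ∀ Y : ℝ, 1 ≤ Y →
        |∑ m₁ ∈ Icc 1 ⌊M⌋₊, ∑ m₂ ∈ Icc 1 ⌊M⌋₊,
            xsq M m₁ / m₁ * (xsq M m₂ / m₂) *
              (h ((m₁ : ℝ) * m₂ / Y) * Real.cos (2 * π * Θ * ((m₁ : ℝ) * m₂ / Y)))| ≤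
          D * ((2 * B + (K + 2 * π * |Θ| * B) * (b - a)) * (1 + |Real.log b|) +
            2 * (K + 2 * π * |Θ| * B) * (Real.sqrt (b * Y) / Y)) / (1 + Real.log Y) ^ k := by
  obtain ⟨D, hD, hmain⟩ := mellinBump_xsq_bv k ha₀
  refine ⟨D, hD, fun a b K B Θ ha hab hK h hLip hsupp hB M hM Y hY ↦ ?_⟩
  have hB0 : 0 ≤ B := (abs_nonneg _).trans (hB 0)
  have hK' : 0 ≤ K + 2 * π * |Θ| * B := by positivity
  refine hmain a b (K + 2 * π * |Θ| * B) B ha hab hK'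
    (fun y ↦ h y * Real.cos (2 * π * Θ * y)) (fun x y ↦ lipschitz_mul_cos hLip hB x y) ?_ ?_ M hM Y hY
  · intro y hy
    exact hsupp y (left_ne_zero_of_mul hy)
  · intro y
    rw [abs_mul]
    exact le_trans (mul_le_of_le_one_right (abs_nonneg _) (Real.abs_cos_le_one _)) (hB y)

/-- **C1 with a sine phase of `Θ` turns** (imaginary-part twin of `mellinBump_xsq_cos`).
[cite: KowalskiMichelVanderKam2000, Prop. 5.1 p. 18 — derivation; MontgomeryVaughan2007, §8.1 (8.6)] -/
theorem mellinBump_xsq_sin (k : ℕ) {a₀ : ℝ} (ha₀ : 0 < a₀) :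
    ∃ D : ℝ, 0 < D ∧ ∀ a b K B Θ : ℝ, a₀ ≤ a → a ≤ b → 0 ≤ K →
      ∀ h : ℝ → ℝ, (∀ x y, |h x - h y| ≤ K * |x - y|) →
      (∀ y, h y ≠ 0 → a ≤ y ∧ y ≤ b) → (∀ y, |h y| ≤ B) → ∀ M : ℝ, 1 < M → ∀ Y : ℝ, 1 ≤ Y →
        |∑ m₁ ∈ Icc 1 ⌊M⌋₊, ∑ m₂ ∈ Icc 1 ⌊M⌋₊,
            xsq M m₁ / m₁ * (xsq M m₂ / m₂) *
              (h ((m₁ : ℝ) * m₂ / Y) * Real.sin (2 * π * Θ * ((m₁ : ℝ) * m₂ / Y)))| ≤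
          D * ((2 * B + (K + 2 * π * |Θ| * B) * (b - a)) * (1 + |Real.log b|) +
            2 * (K + 2 * π * |Θ| * B) * (Real.sqrt (b * Y) / Y)) / (1 + Real.log Y) ^ k := by
  obtain ⟨D, hD, hmain⟩ := mellinBump_xsq_bv k ha₀
  refine ⟨D, hD, fun a b K B Θ ha hab hK h hLip hsupp hB M hM Y hY ↦ ?_⟩
  have hB0 : 0 ≤ B := (abs_nonneg _).trans (hB 0)
  have hK' : 0 ≤ K + 2 * π * |Θ| * B := by positivity
  refine hmain a b (K + 2 * π * |Θ| * B) B ha hab hK'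
    (fun y ↦ h y * Real.sin (2 * π * Θ * y)) (fun x y ↦ lipschitz_mul_sin hLip hB x y) ?_ ?_ M hM Y hY
  · intro y hy
    exact hsupp y (left_ne_zero_of_mul hy)
  · intro y
    rw [abs_mul]
    exact le_trans (mul_le_of_le_one_right (abs_nonneg _) (Real.abs_sin_le_one _)) (hB y)

end Summit.Parity.GeneralizedHardyLittlewood.Theorems.BeyondDiagonalBeatsQuarter.MellinBump
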